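import Literature.AnabelianGeometry.SemiGraphs.ApproximatorBridge
import Literature.AnabelianGeometry.SemiGraphs.ImmersionLiftUnique
import HarnessLib

/-!
# A compact completion of a topological group through which finitely many-valued level actions and an
# augmentation to a compact group factor ([SemiAnbd] §3 Thm 3.7 (iii) / §5 Thm 5.4 (i), completion step)

Mochizuki, *Semi-graphs of anabelioids*, Publ. RIMS **42** (2006): proof of Thm. 3.7 (iii), author's
manuscript p. 41 — the compact subgroup `H` is read through its images
`H_i ⊆ π₁^temp(𝒢)/π₁^temp(𝒢_{∞,i})` in the FINITE quotients of the tower — and Thm. 5.4 (i) p. 66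
(l. 50: "the proofs are entirely parallel to those of Theorem 3.7", with the image in `Π_A` in addition)
[cite: MochizukiSemiAnbd2006, Thm 5.4 (i) p.66].
The cell's arithmetic branch-pair dictionary (AI4″) (abc-iut-w4-d053's `ArithLevelDataCpt.stabBranchPairAug`,
producer abc-iut-w4-d059, row T54-B of GAP-LEDGER G-w4d053-1) is produced by an orbit-closure argument in
a COMPACT Hausdorff group `Q` receiving the arithmetic group `E` densely, through which all finite-level
actions and the augmentation `E → Π_A` factor (abc-iut-w4-d059 2026-08-26T04:46:46Z, piece (P-Q)).

This PROOF-ONLY file (seat abc-iut-w4-d029, piece (P-Q)) CONSTRUCTS that package, for ANY topological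
group `E`, any family of actions `levelAct j : E →* Aut (𝔾_j)` on FINITE semi-graphs with OPEN kernels
and any continuous `aug : E →* Π_A` to a compact Hausdorff group: `Q` := the closure of the image of
`E` in `(∏_j Aut 𝔾_j) × Π_A` (finite discrete factors: a compact Hausdorff group), `ιQ` the corestriction
(continuous, dense), `qAct j` / `augQ` the coordinate projections.  Stated as an EXISTENCE theorem
(`exists_compactCompletion`, universe `max u v`; `exists_compactCompletion_nat` for `ℕ`-indexed towers
in universe `u`, the universe the cell's Thm 5.4 consumer chain is pinned at), with the kernel of `ιQ`
computed (`= (⨅ j, ker levelAct j) ⊓ ker aug`: "faithful on a compact `C`" is then a statement about the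
tower, not about `Q`).  Finiteness of the automorphism groups of the finite levels is abc-iut-w4-d053's
`SemiGraph.finite_aut` (ImmersionLiftUnique.lean), consumed by name.  No definition is introduced; nothing
here bears on [IUTchIII] Cor. 3.12.
-/

namespace Literature.AnabelianGeometry.SemiGraphs

open CategoryTheory Topology

universe v u

/-- **The compact completion package (piece (P-Q) of the (AI4″) producer).**  For a topological group
`E`, actions `levelAct j` of `E` on finite semi-graphs `𝔾_j` with open kernels and a continuous
homomorphism `aug : E → Π_A` to a compact Hausdorff group, there is a compact Hausdorff topological group
`Q` with a continuous homomorphism `ιQ : E → Q` of DENSE range, actions `qAct j : Q →* Aut 𝔾_j` with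
OPEN kernels extending the `levelAct j`, and a continuous `augQ : Q → Π_A` extending `aug`; moreover
`ker ιQ = (⨅ j, ker levelAct j) ⊓ ker aug`.  (Construction: the closure of the image of `E` in
`(∏_j Aut 𝔾_j) × Π_A`.) [cite: MochizukiSemiAnbd2006, Thm 5.4 (i) p.66] -/
theorem exists_compactCompletion {E : Type u} [Group E] [TopologicalSpace E] [IsTopologicalGroup E]
    {PA : Type u} [Group PA] [TopologicalSpace PA] [IsTopologicalGroup PA] [CompactSpace PA]
    [T2Space PA] (aug : E →* PA) (haug : Continuous aug) {J : Type v} (level : J → SemiGraph.{u})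
    [∀ j, Finite (level j).Vertex] [∀ j, Finite (level j).Branch]
    (levelAct : ∀ j, E →* Aut (level j)) (hker : ∀ j, IsOpen ((levelAct j).ker : Set E)) :
    ∃ (Q : Type (max u v)) (_ : Group Q) (_ : TopologicalSpace Q) (_ : IsTopologicalGroup Q)
      (_ : CompactSpace Q) (_ : T2Space Q) (ιQ : E →ₜ* Q) (qAct : ∀ j, Q →* Aut (level j))
      (augQ : Q →ₜ* PA),
      DenseRange ιQ ∧ (∀ j, IsOpen ((qAct j).ker : Set Q)) ∧ (∀ j e, qAct j (ιQ e) = levelAct j e) ∧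
        (∀ e, augQ (ιQ e) = aug e) ∧ ιQ.toMonoidHom.ker = (⨅ j, (levelAct j).ker) ⊓ aug.ker := by
  classical
  letI : ∀ j, TopologicalSpace (Aut (level j)) := fun _ => ⊥
  haveI : ∀ j, DiscreteTopology (Aut (level j)) := fun _ => ⟨rfl⟩
  haveI : ∀ j, Finite (Aut (level j)) := fun j => (level j).finite_aut
  -- the ambient compact Hausdorff group and the diagonal homomorphism
  let Φ : E →* (∀ j, Aut (level j)) × PA := MonoidHom.prod (MonoidHom.pi levelAct) aug
  have hΦc : Continuous Φ := by
    refine Continuous.prodMk (continuous_pi fun j => ?_) haug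
    exact continuous_of_isOpen_ker_of_discreteTopology (levelAct j) (hker j)
  let S : Subgroup ((∀ j, Aut (level j)) × PA) := Φ.range.topologicalClosure
  have hScpt : CompactSpace S :=
    isCompact_iff_compactSpace.mp (Subgroup.isClosed_topologicalClosure _).isCompact
  -- the corestriction `E → S`
  let f : E →* S := (Subgroup.inclusion (Subgroup.le_topologicalClosure Φ.range)).comp Φ.rangeRestrict
  have hf : ∀ e, ((f e : S) : (∀ j, Aut (level j)) × PA) = Φ e := fun _ => rfl
  have hfc : Continuous f := continuous_induced_rng.2 (by
    have : (Subtype.val ∘ f) = Φ := funext hf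
    rw [this]; exact hΦc)
  refine ⟨S, inferInstance, inferInstance, inferInstance, hScpt, inferInstance,
    { toMonoidHom := f, continuous_toFun := hfc },
    fun j => ((Pi.evalMonoidHom (fun j => Aut (level j)) j).comp (MonoidHom.fst _ _)).comp S.subtype,
    { toMonoidHom := (MonoidHom.snd _ _).comp S.subtype,
      continuous_toFun := continuous_snd.comp continuous_subtype_val },
    ?_, fun j => ?_, fun _ _ => rfl, fun _ => rfl, ?_⟩
  · -- dense range: `S` is the closure of the range of `Φ`
    change Dense (Set.range f)
    rw [Subtype.dense_iff]
    intro x hx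
    have hx' : x ∈ closure (Set.range Φ) := by
      simpa only [S, Subgroup.topologicalClosure_coe, MonoidHom.coe_range] using hx
    refine closure_mono ?_ hx'
    rintro _ ⟨e, rfl⟩
    exact ⟨f e, ⟨e, rfl⟩, hf e⟩
  · -- open kernels of the level actions on `Q`
    rw [MonoidHom.coe_ker]
    exact (isOpen_discrete _).preimage
      ((continuous_apply j).comp (continuous_fst.comp continuous_subtype_val))
  · -- the kernel of `ιQ`
    ext e
    rw [MonoidHom.mem_ker, Subgroup.mem_inf, Subgroup.mem_iInf]
    simp only [MonoidHom.mem_ker]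
    change f e = 1 ↔ _
    rw [← Subtype.coe_inj, hf, Subgroup.coe_one, Prod.ext_iff]
    simp only [Φ, MonoidHom.prod_apply, Prod.fst_one, Prod.snd_one, funext_iff, Pi.one_apply]
    exact Iff.rfl

/-- **The compact completion package for an `ℕ`-indexed tower, in the universe of `E`** (the form the
cell's Thm 5.4 consumer chain uses: abc-iut-L3-d4's tower is `ℕ`-indexed and the chain is pinned at one
universe). [cite: MochizukiSemiAnbd2006, Thm 5.4 (i) p.66] -/
theorem exists_compactCompletion_nat {E : Type u} [Group E] [TopologicalSpace E] [IsTopologicalGroup E]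
    {PA : Type u} [Group PA] [TopologicalSpace PA] [IsTopologicalGroup PA] [CompactSpace PA]
    [T2Space PA] (aug : E →* PA) (haug : Continuous aug) (level : ℕ → SemiGraph.{u})
    [∀ j, Finite (level j).Vertex] [∀ j, Finite (level j).Branch]
    (levelAct : ∀ j, E →* Aut (level j)) (hker : ∀ j, IsOpen ((levelAct j).ker : Set E)) :
    ∃ (Q : Type u) (_ : Group Q) (_ : TopologicalSpace Q) (_ : IsTopologicalGroup Q)
      (_ : CompactSpace Q) (_ : T2Space Q) (ιQ : E →ₜ* Q) (qAct : ∀ j, Q →* Aut (level j))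
      (augQ : Q →ₜ* PA),
      DenseRange ιQ ∧ (∀ j, IsOpen ((qAct j).ker : Set Q)) ∧ (∀ j e, qAct j (ιQ e) = levelAct j e) ∧
        (∀ e, augQ (ιQ e) = aug e) ∧ ιQ.toMonoidHom.ker = (⨅ j, (levelAct j).ker) ⊓ aug.ker :=
  exists_compactCompletion aug haug level levelAct hker

/-- **Completeness of a compact group along a tower of open subgroups** (the binder `hcomplete` of
abc-iut-w4-d085's `SubgroupPresentation.hlift_of_complete` / `exists_doubleCoset_lift_of_complete`,
piece (P-K), DISCHARGED for compact groups — in particular for the compact completion `Q` of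
`exists_compactCompletion` with `K j := ker (qAct j)`): over a directed index, every family `z` that is
Cauchy for an antitone family of open subgroups `K j` (`(z i)⁻¹ z j ∈ K i` for `i ≤ j`) has a limit `g`
(`g⁻¹ z j ∈ K j` for all `j`) — the left cosets `z j · K j` are nonempty, closed and decreasing, so they
meet by compactness ([SemiAnbd] proof of Thm 3.7 (iii) p. 41, the compactness of `H` read in the finite
quotients). [cite: MochizukiSemiAnbd2006, Thm 3.7 (iii) p.41] -/
theorem hcomplete_of_compactSpace {Γ : Type u} [Group Γ] [TopologicalSpace Γ] [IsTopologicalGroup Γ]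
    [CompactSpace Γ] {J : Type v} [Preorder J] [IsDirected J (· ≤ ·)] [Nonempty J]
    (K : J → Subgroup Γ) (hK : ∀ ⦃i j : J⦄, i ≤ j → K j ≤ K i) (hKo : ∀ j, IsOpen (K j : Set Γ))
    (z : J → Γ) (hz : ∀ ⦃i j : J⦄, i ≤ j → (z i)⁻¹ * z j ∈ K i) : ∃ g : Γ, ∀ j, g⁻¹ * z j ∈ K j := by
  -- the cosets `T j := {g | (z j)⁻¹ g ∈ K j} = z j · K j`
  let T : J → Set Γ := fun j => (fun g => (z j)⁻¹ * g) ⁻¹' (K j : Set Γ)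
  have hTcl : ∀ j, IsClosed (T j) := fun j =>
    ((K j).isClosed_of_isOpen (hKo j)).preimage (continuous_const.mul continuous_id)
  have hTne : ∀ j, (T j).Nonempty := fun j => ⟨z j, by simp [T]⟩
  have hTanti : ∀ ⦃i j : J⦄, i ≤ j → T j ⊆ T i := fun i j hij g hg => by
    simp only [T, Set.mem_preimage, SetLike.mem_coe] at hg ⊢
    have : (z i)⁻¹ * g = ((z i)⁻¹ * z j) * ((z j)⁻¹ * g) := by group
    rw [this]
    exact (K i).mul_mem (hz hij) (hK hij hg)
  have hdir : Directed (· ⊇ ·) T := directed_of_isDirected_le fun i j hij => hTanti hij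
  obtain ⟨g, hg⟩ := IsCompact.nonempty_iInter_of_directed_nonempty_isCompact_isClosed T hdir hTne
    (fun j => (hTcl j).isCompact) hTcl
  refine ⟨g, fun j => ?_⟩
  have hgj : (z j)⁻¹ * g ∈ K j := by
    have := Set.mem_iInter.mp hg j
    simpa [T] using this
  simpa using (K j).inv_mem hgj

end Literature.AnabelianGeometry.SemiGraphs
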